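import Literature.AlgebraicGeometry.Motives.HodgeStructureCentralizerRestrictionToRepresentatives
import Literature.AlgebraicGeometry.Motives.HodgeStructureCentralizerBaseChange
import Mathlib.RingTheory.TensorProduct.Pi
import HarnessLib

/-!
# MILNE'S PROP. 1.1 ON `K`-POINTS IN CANONICAL FORM: for every field `K ⊇ ℚ`, RESTRICTION TO THE REPRESENTATIVES is an isomorphism of
# `K`-algebras `C(H)(K) ≃ₐ[K] Π_k C(T_k)(K)` — `(ι_k)_K ∘ (E c)_k = c ∘ (ι_k)_K` on `K ⊗ T_k` — obtained by base-changing the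
# canonical `ℚ`-isomorphism `C(H) ≃ₐ Π_k C(T_k)` along Remark 1.6 `C(·)(K) ≅ K ⊗_ℚ C(·)` (Milne 1999 §1 Prop. 1.1 with Remark 1.6)

[topic AlgebraicGeometry/Motives]

Layer `Literature/AlgebraicGeometry/Motives`, lane `lit-hodgefound` (Track 2 foundations library; prover seat
`lit-hodgefound-p02`, generation 53, self-proposed row g53-#6). THEOREMS ONLY: no definition, no named fact (net debt `0`),
no instance, no notation.  Sequel, BY NAME (nothing restated), of g53-#1 `Motives/HodgeStructureCentralizerRestrictionToRepresentatives`
(`exists_algEquiv_pi_centralizer_of_labelling`: restriction to the representatives `e : C(H) ≃ₐ[ℚ] Π_k C(T_k)`, `(e γ)_k v = γ v`) and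
g53-#5 `Motives/HodgeStructureCentralizerBaseChange` (Remark 1.6 literally: `K ⊗_ℚ C(·) ≃ₐ[K] C(·)(K)`, `k ⊗ γ ↦ k · γ_K`); Mathlib's
`Algebra.TensorProduct.congr` and `Algebra.TensorProduct.piRight` (`K ⊗ Π_k = Π_k K ⊗`).  g52-#10
(`Motives/HodgeStructureCentralizerInternalBlocksPoints`, `nonempty_centralizer_baseChange_algEquiv_pi_of_labelling`) has the
`K`-points isomorphism as a bare `Nonempty`; here it is the base change of the canonical one, with its formula.

## The source, verbatim

J. S. Milne, *Lefschetz classes on abelian varieties*, Duke Math. J. 96 (1999) 639–675 [Milne1999LefschetzClasses] (held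
`paper:doi-10-1215-s0012-7094-99-09620-5`), p. 643 L24–L28: "**Proposition 1.1.** Let `A₁, …, A_s` be a set of representatives for
the simple isogeny factors of `A` […]. Any such isogeny induces an isomorphism `C(A₁) × ⋯ × C(A_s) → C(A)` of `k`-algebras with
involution, which is independent of the choice of the isogeny."; p. 644 L29–L34: "**Remark 1.6.** […] there are canonical
isomorphisms `C'(A) ≅ C(A) ⊗_k k'`, `S'(A) ≅ S(A)_{/k'}`."  Also N. Bourbaki [BourbakiAlgebraI1989] Ch. II §5 no. 3 Prop. 7 (base
change commutes with finite products and with `Hom` of finite free modules).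

## Dictionary and what is proved (namespace `Literature.AlgebraicGeometry.Motives.HodgeStructure`)

`C(H)(K) = Subalgebra.centralizer K ((fun a ↦ a.baseChange K) '' E_φ(H)) ⊆ End_K(K ⊗_ℚ V)`, `C(T_k)(K)` likewise inside
`End_K(K ⊗_ℚ T_k)`; `(ι_k)_K = (T k).toSubmodule.subtype.baseChange K : K ⊗ T_k → K ⊗ V`; `T : ι → SubHodgeStructure H` an internal
direct sum with isotypic labelling `c : ι → κ`, `κ ⊆ ι`.

* `subtype_comp_eq_comp_subtype_of_forall_coe_apply_eq` (the `ℚ`-formula `(e γ)_k v = γ v` as `ι_k ∘ (e γ)_k = γ ∘ ι_k`),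
  `centralizer_baseChange_pi_map_eq_of_forall_baseChange_apply` (UNIQUENESS on `K`-points: two maps `C(H)(K) → Π_k C(T_k)(K)` over
  the base-changed restrictions coincide, `(ι_k)_K` being injective — «independent of the choice»),
  **`exists_centralizer_baseChange_algEquiv_pi_of_labelling`** (PROP. 1.1 ON `K`-POINTS, canonical form:
  `E : C(H)(K) ≃ₐ[K] Π_{k ∈ κ} C(T_k)(K)` with `(ι_k)_K ((E c)_k x) = c ((ι_k)_K x)`), `Polarization.restrict_form_baseChange_apply`
  (`(ψ|_S)_K = ψ_K ∘ ((ι_S)_K × (ι_S)_K)`), **`Polarization.coe_map_centralizerAdjoint_eq_adjointBaseChange_of_forall_baseChange_apply`**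
  («with involution» on `K`-points: any map over the base-changed restrictions carries `†_K` to `Π_k †_{K,k}`),
  `Polarization.exists_centralizer_baseChange_algEquiv_pi_adjoint_of_labelling` (packaged).
-/

noncomputable section

open scoped TensorProduct

namespace Literature.AlgebraicGeometry.Motives

namespace HodgeStructure

universe u uK

variable (K : Type uK) [Field K] [Algebra ℚ K] {V : Type u} [AddCommGroup V] [Module ℚ V] {n : ℤ} {H : HodgeStructure V n}

/-- **The restricted polarization on `K`-points**: `(ψ|_S)_K(x, y) = ψ_K((ι_S)_K x, (ι_S)_K y)` for `x, y ∈ K ⊗ S` (on pure tensors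
`(a ⊗ v, b ⊗ w) ↦ ψ(v, w) · ab` on both sides; the tree has this identity only as the `private` lemmas `restrict_baseChange_form₁₁ ∕ ₁₃` of
`Motives/HodgeStructureHodgeVectorBlockLefschetzSimilitude{Restriction,MulEquiv}` — here public, for reuse).
[cite: Milne1999LefschetzClasses, §1 Remark 1.6 (p. 644)] [cite: VoisinHodgeI2002, §7.3.1 Lemma 7.26] -/
theorem Polarization.restrict_form_baseChange_apply (ψ : Polarization H) (S : SubHodgeStructure H) (x y : K ⊗[ℚ] S.toSubmodule) :
    (ψ.restrict S).form.baseChange K x y =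
      ψ.form.baseChange K (S.toSubmodule.subtype.baseChange K x) (S.toSubmodule.subtype.baseChange K y) := by
  induction x using TensorProduct.induction_on with
  | zero => rw [map_zero, LinearMap.zero_apply, map_zero, map_zero, LinearMap.zero_apply]
  | add x x' hx hx' => rw [map_add, LinearMap.add_apply, hx, hx', map_add, map_add, LinearMap.add_apply]
  | tmul a v =>
    induction y using TensorProduct.induction_on with
    | zero => rw [map_zero, map_zero, map_zero]
    | add y y' hy hy' => rw [map_add, hy, hy', map_add, map_add]
    | tmul b w =>
      rw [LinearMap.BilinForm.baseChange_tmul, LinearMap.baseChange_tmul, LinearMap.baseChange_tmul,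
        LinearMap.BilinForm.baseChange_tmul, Polarization.restrict_form_apply, Submodule.subtype_apply, Submodule.subtype_apply]

section Labelled

variable {ι : Type*} [Fintype ι] [DecidableEq ι] (T : ι → SubHodgeStructure H)
  (hT : DirectSum.IsInternal fun i => (T i).toSubmodule) {κ : Finset ι} {c : ι → κ}
  (hc : ∀ i, ∃ g : Hom (T i).toHodgeStructure (T (c i)).toHodgeStructure, Function.Bijective g.toLinearMap)
  (hκ : ∀ k k' : κ, (∃ g : Hom (T k).toHodgeStructure (T k').toHodgeStructure,
    Function.Bijective g.toLinearMap) → k = k')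

omit [Fintype ι] [DecidableEq ι] in
/-- The `ℚ`-formula `(e γ)_k v = γ v` of g53-#1, read as an identity of linear maps `ι_k ∘ (e γ)_k = γ ∘ ι_k : T_k → V`.
[cite: Milne1999LefschetzClasses, §1 Prop. 1.1 (p. 643)] -/
theorem subtype_comp_eq_comp_subtype_of_forall_coe_apply_eq
    (e : Subalgebra.centralizer ℚ (H.endAlg : Set (Module.End ℚ V)) →
      Π k : κ, Subalgebra.centralizer ℚ (((T k).toHodgeStructure).endAlg : Set (Module.End ℚ (T k).toSubmodule)))
    (he : ∀ (γ : Subalgebra.centralizer ℚ (H.endAlg : Set (Module.End ℚ V))) (k : κ) (v : (T k).toSubmodule),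
      ((e γ k : Module.End ℚ (T k).toSubmodule) v : V) = (γ : Module.End ℚ V) v)
    (γ : Subalgebra.centralizer ℚ (H.endAlg : Set (Module.End ℚ V))) (k : κ) :
    (T k).toSubmodule.subtype ∘ₗ (e γ k : Module.End ℚ (T k).toSubmodule) = (γ : Module.End ℚ V) ∘ₗ (T k).toSubmodule.subtype :=
  LinearMap.ext fun v => he γ k v

omit [Fintype ι] [DecidableEq ι] in
/-- **«independent of the choice» on `K`-points**: two maps `E, E' : C(H)(K) → Π_{k ∈ κ} C(T_k)(K)` both lying over the base-changed
restrictions (`(ι_k)_K ∘ (E c)_k = c ∘ (ι_k)_K = (ι_k)_K ∘ (E' c)_k`) COINCIDE, since `(ι_k)_K : K ⊗ T_k → K ⊗ V` is injective (`K` is flat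
over `ℚ`). [cite: Milne1999LefschetzClasses, §1 Prop. 1.1 (p. 643) and Remark 1.6 (p. 644)] [cite: BourbakiAlgebraI1989, Ch. II §5 no. 3 Prop. 7] -/
theorem centralizer_baseChange_pi_map_eq_of_forall_baseChange_apply
    (E E' : Subalgebra.centralizer K ((fun a : Module.End ℚ V => a.baseChange K) '' (H.endAlg : Set (Module.End ℚ V))) →
      Π k : κ, Subalgebra.centralizer K ((fun a : Module.End ℚ (T k).toSubmodule => a.baseChange K) ''
        (((T k).toHodgeStructure).endAlg : Set (Module.End ℚ (T k).toSubmodule))))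
    (hE : ∀ (c : Subalgebra.centralizer K ((fun a : Module.End ℚ V => a.baseChange K) '' (H.endAlg : Set (Module.End ℚ V))))
      (k : κ) (x : K ⊗[ℚ] (T k).toSubmodule),
      (T k).toSubmodule.subtype.baseChange K
          (((E c k : Subalgebra.centralizer K ((fun a : Module.End ℚ (T k).toSubmodule => a.baseChange K) ''
            (((T k).toHodgeStructure).endAlg : Set (Module.End ℚ (T k).toSubmodule)))) :
              Module.End K (K ⊗[ℚ] (T k).toSubmodule)) x) =
        (c : Module.End K (K ⊗[ℚ] V)) ((T k).toSubmodule.subtype.baseChange K x))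
    (hE' : ∀ (c : Subalgebra.centralizer K ((fun a : Module.End ℚ V => a.baseChange K) '' (H.endAlg : Set (Module.End ℚ V))))
      (k : κ) (x : K ⊗[ℚ] (T k).toSubmodule),
      (T k).toSubmodule.subtype.baseChange K
          (((E' c k : Subalgebra.centralizer K ((fun a : Module.End ℚ (T k).toSubmodule => a.baseChange K) ''
            (((T k).toHodgeStructure).endAlg : Set (Module.End ℚ (T k).toSubmodule)))) :
              Module.End K (K ⊗[ℚ] (T k).toSubmodule)) x) =
        (c : Module.End K (K ⊗[ℚ] V)) ((T k).toSubmodule.subtype.baseChange K x)) :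
    E = E' := by
  have hinj : ∀ k : κ, Function.Injective ((T (k : ι)).toSubmodule.subtype.baseChange K) := fun k => by
    rw [LinearMap.baseChange_eq_ltensor]
    exact Module.Flat.lTensor_preserves_injective_linearMap _ (T (k : ι)).toSubmodule.injective_subtype
  exact funext fun c => funext fun k => Subtype.ext (LinearMap.ext fun x => hinj k (by rw [hE, hE']))

omit [Fintype ι] [DecidableEq ι] in
/-- **«of `k`-algebras with involution» on `K`-points: ANY map `E : C(H)(K) → Π_{k ∈ κ} C(T_k)(K)` over the base-changed restrictions
carries the `K`-adjoint `†_K` of `ψ` (p34's `Polarization.centralizerAdjoint`) to the `K`-adjoints of the `ψ|_{T_k}`**: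
`(E c^{†_K})_k = ((E c)_k)^{†_K}` — `(ψ|_{T_k})_K((E c)_k x, y) = ψ_K(c (ι x), ι y) = ψ_K(ι x, c^{†_K} (ι y)) = (ψ|_{T_k})_K(x, (E c^{†_K})_k y)` and
`K`-adjoints for the non-degenerate `(ψ|_{T_k})_K` are unique. [cite: Milne1999LefschetzClasses, §1 Prop. 1.1 (p. 643) and Remark 1.6 (p. 644)]
[cite: Huybrechts2016K3, §3.3.5 eq. (3.3)] -/
theorem Polarization.coe_map_centralizerAdjoint_eq_adjointBaseChange_of_forall_baseChange_apply [Module.Finite ℚ V]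
    (ψ : Polarization H)
    (E : Subalgebra.centralizer K ((fun a : Module.End ℚ V => a.baseChange K) '' (H.endAlg : Set (Module.End ℚ V))) →
      Π k : κ, Subalgebra.centralizer K ((fun a : Module.End ℚ (T k).toSubmodule => a.baseChange K) ''
        (((T k).toHodgeStructure).endAlg : Set (Module.End ℚ (T k).toSubmodule))))
    (hE : ∀ (c : Subalgebra.centralizer K ((fun a : Module.End ℚ V => a.baseChange K) '' (H.endAlg : Set (Module.End ℚ V))))
      (k : κ) (x : K ⊗[ℚ] (T k).toSubmodule),
      (T k).toSubmodule.subtype.baseChange K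
          (((E c k : Subalgebra.centralizer K ((fun a : Module.End ℚ (T k).toSubmodule => a.baseChange K) ''
            (((T k).toHodgeStructure).endAlg : Set (Module.End ℚ (T k).toSubmodule)))) :
              Module.End K (K ⊗[ℚ] (T k).toSubmodule)) x) =
        (c : Module.End K (K ⊗[ℚ] V)) ((T k).toSubmodule.subtype.baseChange K x))
    (c : Subalgebra.centralizer K ((fun a : Module.End ℚ V => a.baseChange K) '' (H.endAlg : Set (Module.End ℚ V)))) (k : κ) :
    ((E (ψ.centralizerAdjoint K c) k : Subalgebra.centralizer K ((fun a : Module.End ℚ (T k).toSubmodule => a.baseChange K) ''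
        (((T k).toHodgeStructure).endAlg : Set (Module.End ℚ (T k).toSubmodule)))) : Module.End K (K ⊗[ℚ] (T k).toSubmodule)) =
      (ψ.restrict (T k)).adjointBaseChange K ((E c k : Subalgebra.centralizer K ((fun a : Module.End ℚ (T k).toSubmodule =>
        a.baseChange K) '' (((T k).toHodgeStructure).endAlg : Set (Module.End ℚ (T k).toSubmodule)))) :
          Module.End K (K ⊗[ℚ] (T k).toSubmodule)) := by
  refine (ψ.restrict (T k)).eq_adjointBaseChange_of_isAdjointPair K fun x y => ?_
  rw [ψ.restrict_form_baseChange_apply K (T k), ψ.restrict_form_baseChange_apply K (T k), hE, hE,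
    Polarization.coe_centralizerAdjoint, ψ.baseChange_form_apply_adjointBaseChange K]


include hT hc hκ

variable [Module.Finite ℚ V]

set_option maxHeartbeats 400000 in
/-- **MILNE'S PROPOSITION 1.1 ON `K`-POINTS, CANONICAL FORM** («`C'(A) ≅ C(A) ⊗_k k'`»): for every field `K ⊇ ℚ` and every
isotypically labelled irreducible decomposition `V = ⊕ᵢ Tᵢ` of a finite-dimensional `ℚ`-Hodge structure, there is an isomorphism of
`K`-algebras `E : C(H)(K) ≃ₐ[K] Π_{k ∈ κ} C(T_k)(K)` which is RESTRICTION TO THE (base-changed) REPRESENTATIVES: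
`(ι_k)_K ((E c)_k x) = c ((ι_k)_K x)` for `x ∈ K ⊗ T_k` — the base change `K ⊗_ℚ (·)` of the canonical `ℚ`-isomorphism of g53-#1,
transported through Remark 1.6 `C(·)(K) ≅ K ⊗_ℚ C(·)` (g53-#5) and `K ⊗ Π_k C(T_k) = Π_k K ⊗ C(T_k)`; on `k' · γ_K` it is
`(k' · (γ|_{T_k})_K)_k`. [cite: Milne1999LefschetzClasses, §1 Prop. 1.1 (p. 643) and Remark 1.6 (p. 644)]
[cite: BourbakiAlgebraI1989, Ch. II §5 no. 3 Prop. 7] -/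
theorem exists_centralizer_baseChange_algEquiv_pi_of_labelling (hirr : ∀ i, (T i).toHodgeStructure.IsIrreducible) :
    ∃ E : Subalgebra.centralizer K ((fun a : Module.End ℚ V => a.baseChange K) '' (H.endAlg : Set (Module.End ℚ V))) ≃ₐ[K]
        Π k : κ, Subalgebra.centralizer K ((fun a : Module.End ℚ (T k).toSubmodule => a.baseChange K) ''
          (((T k).toHodgeStructure).endAlg : Set (Module.End ℚ (T k).toSubmodule))),
      ∀ (c : Subalgebra.centralizer K ((fun a : Module.End ℚ V => a.baseChange K) '' (H.endAlg : Set (Module.End ℚ V))))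
        (k : κ) (x : K ⊗[ℚ] (T k).toSubmodule),
        (T k).toSubmodule.subtype.baseChange K
            (((E c k : Subalgebra.centralizer K ((fun a : Module.End ℚ (T k).toSubmodule => a.baseChange K) ''
              (((T k).toHodgeStructure).endAlg : Set (Module.End ℚ (T k).toSubmodule)))) :
                Module.End K (K ⊗[ℚ] (T k).toSubmodule)) x) =
          (c : Module.End K (K ⊗[ℚ] V)) ((T k).toSubmodule.subtype.baseChange K x) := by
  -- the canonical `ℚ`-isomorphism (g53-#1) and Remark 1.6 for `H` and for each `T_k` (g53-#5)
  obtain ⟨e, he⟩ := exists_algEquiv_pi_centralizer_of_labelling T hT hc hκ hirr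
  obtain ⟨eH, heH⟩ := exists_baseChange_centralizer_algEquiv K H
  choose eT heT using fun k : κ => exists_baseChange_centralizer_algEquiv K (T k).toHodgeStructure
  refine ⟨eH.symm.trans ((Algebra.TensorProduct.congr (AlgEquiv.refl : K ≃ₐ[K] K) e).trans
    ((Algebra.TensorProduct.piRight ℚ K K fun k : κ =>
      Subalgebra.centralizer ℚ (((T k).toHodgeStructure).endAlg : Set (Module.End ℚ (T k).toSubmodule))).trans
        (AlgEquiv.piCongrRight eT))), fun c' k x => ?_⟩
  obtain ⟨y, rfl⟩ : ∃ y, c' = eH y := ⟨eH.symm c', (eH.apply_symm_apply c').symm⟩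
  rw [AlgEquiv.trans_apply, AlgEquiv.symm_apply_apply, AlgEquiv.trans_apply, AlgEquiv.trans_apply,
    AlgEquiv.piCongrRight_apply]
  induction y using TensorProduct.induction_on generalizing x with
  | zero =>
    simp only [map_zero, Pi.zero_apply, ZeroMemClass.coe_zero, LinearMap.zero_apply]
  | add y y' hy hy' =>
    simp only [map_add, Pi.add_apply, AddMemClass.coe_add, LinearMap.add_apply, hy, hy']
  | tmul k' γ =>
    rw [Algebra.TensorProduct.congr_apply, Algebra.TensorProduct.map_tmul, Algebra.TensorProduct.piRight_tmul, heT, heH]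
    simp only [AlgEquiv.coe_toAlgHom, AlgEquiv.coe_refl, id_eq]
    rw [LinearMap.smul_apply, LinearMap.smul_apply, map_smul,
      ← LinearMap.comp_apply ((T k).toSubmodule.subtype.baseChange K), ← LinearMap.baseChange_comp,
      subtype_comp_eq_comp_subtype_of_forall_coe_apply_eq T e he γ k, LinearMap.baseChange_comp, LinearMap.comp_apply]

/-- **PROP. 1.1 ON `K`-POINTS «OF `k`-ALGEBRAS WITH INVOLUTION», packaged**: the restriction isomorphism
`E : C(H)(K) ≃ₐ[K] Π_{k ∈ κ} C(T_k)(K)` together with `(E c^{†_K})_k = ((E c)_k)^{†_K}` for every polarization `ψ` of `H`.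
[cite: Milne1999LefschetzClasses, §1 Prop. 1.1 (p. 643) and Remark 1.6 (p. 644)] [cite: Huybrechts2016K3, §3.3.5 eq. (3.3)] -/
theorem Polarization.exists_centralizer_baseChange_algEquiv_pi_adjoint_of_labelling (ψ : Polarization H)
    (hirr : ∀ i, (T i).toHodgeStructure.IsIrreducible) :
    ∃ E : Subalgebra.centralizer K ((fun a : Module.End ℚ V => a.baseChange K) '' (H.endAlg : Set (Module.End ℚ V))) ≃ₐ[K]
        Π k : κ, Subalgebra.centralizer K ((fun a : Module.End ℚ (T k).toSubmodule => a.baseChange K) ''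
          (((T k).toHodgeStructure).endAlg : Set (Module.End ℚ (T k).toSubmodule))),
      (∀ (c : Subalgebra.centralizer K ((fun a : Module.End ℚ V => a.baseChange K) '' (H.endAlg : Set (Module.End ℚ V))))
          (k : κ) (x : K ⊗[ℚ] (T k).toSubmodule),
        (T k).toSubmodule.subtype.baseChange K
            (((E c k : Subalgebra.centralizer K ((fun a : Module.End ℚ (T k).toSubmodule => a.baseChange K) ''
              (((T k).toHodgeStructure).endAlg : Set (Module.End ℚ (T k).toSubmodule)))) :
                Module.End K (K ⊗[ℚ] (T k).toSubmodule)) x) =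
          (c : Module.End K (K ⊗[ℚ] V)) ((T k).toSubmodule.subtype.baseChange K x)) ∧
      ∀ (c : Subalgebra.centralizer K ((fun a : Module.End ℚ V => a.baseChange K) '' (H.endAlg : Set (Module.End ℚ V))))
          (k : κ),
        ((E (ψ.centralizerAdjoint K c) k : Subalgebra.centralizer K ((fun a : Module.End ℚ (T k).toSubmodule => a.baseChange K) ''
            (((T k).toHodgeStructure).endAlg : Set (Module.End ℚ (T k).toSubmodule)))) :
              Module.End K (K ⊗[ℚ] (T k).toSubmodule)) =
          (ψ.restrict (T k)).adjointBaseChange K ((E c k : Subalgebra.centralizer K ((fun a : Module.End ℚ (T k).toSubmodule =>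
            a.baseChange K) '' (((T k).toHodgeStructure).endAlg : Set (Module.End ℚ (T k).toSubmodule)))) :
              Module.End K (K ⊗[ℚ] (T k).toSubmodule)) := by
  obtain ⟨E, hE⟩ := exists_centralizer_baseChange_algEquiv_pi_of_labelling K T hT hc hκ hirr
  exact ⟨E, hE, fun c k => ψ.coe_map_centralizerAdjoint_eq_adjointBaseChange_of_forall_baseChange_apply K T E hE c k⟩

end Labelled

end HodgeStructure

end Literature.AlgebraicGeometry.Motives
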